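import Mathlib
import HarnessLib
import HarnessLib.Audit
import Summits.AtomisticToContinuum.Statement

/-!
Route: LaceRingBootstrap

CLOSED (retired) 2026-08-15T13:43:42Z by operator:999:1257524 — reason: not-a-thesis: assembly does not conclude the sub-problem Statement — note: D-0027 §2.1 audit (human 2026-08-15: routes that do not decide the summit are removed): the assembly concludes `Literature.MathematicalPhysics.KineticTheory.HydrodynamicLimit`, not the sub-problem statement; a NEW conforming route may be opened from the same idea (generated `closes : … → _root_.Hydr. The file is kept as the record of this route; refuted decls are indexed as negative knowledge (`ledger negatives`).

# Route LaceRingBootstrap — lace expansion of collision histories — dressed ring self-energy with a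
Hara–Slade bootstrap uniform in kinetic time at fixed small packing

X (LACE–RING BOOTSTRAP; "it suffices to show"), realising card lace-expansion-ring-bootstrap. X =
X_eq ∧ X_neq. X_eq: at reduced density σ < σ₀ (packing φ = πσ³/6) the equilibrium tagged-particle /
pair propagator of the deterministic hard-sphere gas has the Dyson–Ornstein–Zernike form P̂(z) = [z
− ℒ_E − Σ(z)]⁻¹ around the DRESSED (collision-damped) linear Enskog reference, the self-energy Σ
being a CONVERGENT sum over irreducible ring diagrams — laces on the kinetic time axis, a
"self-intersection" being the re-encounter of causally upstream information — with ‖Π^(m)‖ ≤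
(C·R(φ))^m for the dressed re-encounter bubble R(φ) → 0 (d = 3 lies above the BALLISTIC critical
dimension 2: the ring-closure kernel ∫dτ τ^-(d−1) converges, NoDensityExpansion kernel (2)), the
bounds being closed by the Hara–Slade continuity bootstrap UNIFORMLY in kinetic time (Re z → 0⁺,
tolerating the z^1/2 branch point of the long-time tail). X_neq: the same expansion around the local
Enskog process driven by a classical hs-Euler solution converges uniformly on [0, T·N^1/3] kinetic
times. Typed content, in increasing reach: K1 = EquilibriumVafEnvelope (all-kinetic-time envelope of
the equilibrium velocity autocorrelation at FIXED σ: exponential kinetic part + K σ³ (1+s)^-3/2 ring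
tail — Spohn's "not even lim x(t)/t = 0 is proved", and far beyond), K2 = EquilibriumLinearResponse
(Euler-scale equilibrium response = linearised hs-Euler, Landau–Placzek; the five-charge sector of
the bootstrap; item shared with route OneParticleInfluence), K3 = LocalEquilibriumMarginals (1- and
2-marginals in local equilibrium along hs-Euler; the typed s ≤ 2 shadow shared with
DenseKineticExpansion's FixedFractionCumulantExpansion, for which this route is an alternative
ENGINE with a named small parameter R(φ) and a named reason for time-uniformity). K3 → MarginalsToL2
→ FlowMarginalSymmetry → HydrodynamicLimit is measure theory (Chebyshev).
Lean: `EquilibriumVafEnvelope ∧ EquilibriumLinearResponse ∧ LocalEquilibriumMarginals`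

## Assembly
Measure theory, no physics: fix profiles and take σ₀ from LocalEquilibriumMarginals; for σ < σ₀, a
classical solution on [0,T), flows Φ, the t = 0 hypothesis and t ∈ [0,T): LocalEquilibriumMarginals
gives the two weighted-L¹ marginal limits; continuity of ρ_t, u_t, θ_t and θ_t > 0 come from
IsHardSphereEulerSolution (IsSmoothSpaceTimeOn on [0,T)×𝕋³ ⇒ continuity of the time-t slice through
the quotient map Torus.proj); FlowMarginalSymmetry supplies the a.e. symmetry hypothesis;
MarginalsToL2 then yields the three mean-square limits at t, and Chebyshev in ℝ≥0∞
(MeasureTheory.mul_meas_ge_le_lintegral₀ with f z = ofReal |F((Φ N).flow t z)|², measurability from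
HardSphereFlow.measurable_flow and continuity of χ; the proof pattern already attached as evidence
to stmt-0801) turns them into TendstoHydroFieldsAt at t. K1 and K2 are the engine's rungs
(equilibrium sector: tagged propagator, then five-charge sector) and are deliberately NOT
antecedents of the assembly, exactly as the steady Liouville rung of the template example.

Rationale: WHY THIS LINE. Every kinetic expansion on the board (Lanford; DengHaniMa2024 layered molecules;
DenseKineticExpansion's re-centred cumulants) is organised by collision HISTORIES and dies at a
horizon of a few mean free times at fixed density (Cohen1967 §2 (11b), §4a), whereas the conjunct's
unit of time is ≍ N^1/3 mean free times; the one rigorous technology whose hallmark is convergence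
UNIFORM IN LENGTH around a memoryless reference from a small bubble is the lace expansion
(BrydgesSpencer1985; HaraSlade1992; Slade2006LaceExpansion Thm 4.1, Thm 5.8, bootstrap Lemma 5.9;
ballistic d = 1 version VanDerHofstad2001Ballistic; general self-interacting walks
VanderhofstadHolmes2012), imported here from critical phenomena / probability with an explicit
dictionary: walk length ↦ kinetic time, SRW transition ↦ dressed linear Enskog semigroup, two-point
function ↦ tagged/pair propagator of the infinite equilibrium gas (Alexander1975), self-intersection
↦ ring closure (re-encounter of dynamical information), lace ↦ irreducible ring diagram = the
kinetic theorists' ring self-energy (KawasakiOppenheim1967; VanLeeuwenWeijland1967 (12), (16);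
Dorfman1999 §16.2), bubble ↦ dressed re-encounter bubble R(φ), upper critical dimension d > 4 ↦
ballistic transience d > 2 (Cohen1967 (13)–(14): ∫dτ/τ² < ∞ in d = 3, log-divergent for disks,
exactly as SAW in d = 4), Hara–Slade bootstrap in n ↦ bootstrap in kinetic time down to Re z → 0⁺.
Physicists' self-consistent ring / mode-coupling theory (DorfmanCohen1972; ErnstHaugeVanleeuwen1970;
Resibois1978) IS an uncontrolled bootstrap for Σ on dressed propagators; the delta is an
inclusion–exclusion-exact lace representation plus the continuity argument in place of a closure.
Rigorous neighbours one level away, none uniform in time at fixed density: renormalised-propagator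
graph expansions beyond the kinetic time (ErdosSalmhoferYau2008, quantum Lorentz), transience-based
control of the random Lorentz gas beyond Boltzmann–Grad (LutskoToth2020, arXiv:2501.00519), tagged
sphere to Brownian motion at Boltzmann–Grad for (log log N)-times
(BodineauGallagherSaintRaymondInvent2016), equilibrium fluctuations for long kinetic times in the
dilute regime (BGSSCPAM2023 Thm 1.1). What this line does that prior routes do not: it names the
small parameter at FIXED σ (the dressed bubble R(φ), not σ³ per se) and the mechanism for uniformity
in time (ballistic transience + bootstrap), organises the expansion by CORRELATION rather than
INFLUENCE (so the branching horizon of history expansions is irrelevant: in equilibrium one-time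
contact statistics are exactly product whatever the shared history), and delivers a first typed
theorem (K1) that no other route states. Negatives index: empty at filing.

RANKED CRUXES. #2 EquilibriumVafEnvelope (crux) — K1 (card K1/L1–L3 exercised in their home
setting): there are σ₀, c > 0 and constants A, K such that for every reduced density 0 < σ < σ₀,
every family of hard-sphere flows of N+1 spheres of diameter σ(N+1)^(-1/3) on 𝕋³ and every kinetic
time s ≥ 0, the equilibrium velocity autocorrelation C_N(s) = E_G[(N+1)⁻¹ Σ_i v_i(0)·v_i(t)] under
the canonical hard-sphere Gibbs law with unit-temperature Maxwellian velocities (localGibbsLaw σ 1 0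
1), read at macroscopic time t = s/((N+1)ε_N²) = s/(σ²(N+1)^(1/3)) (s counts mean free times up to
the factor 4√π·χ(φ)), satisfies for every δ > 0 and all large N: |C_N(s)| ≤ 3(A e^(−cs) + K σ³
(1+s)^(−3/2)) + δ. Content: the tagged velocity decorrelates at fixed positive density for ALL
kinetic times with an integrable envelope — exponential kinetic (Enskog) part plus a ring correction
of relative size O(φ) with the t^(−3/2) long-time-tail exponent — hence finite self-diffusion
(Green–Kubo integrable), zero self-Drude weight, x(t)/t → 0; the lace engine gives more (C = Enskog
VAF + ring term ≤ C R(φ)(1+s)^(−3/2), D = D_E(1+O(φ² log φ))) but the envelope is the typed,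
falsifiable core. C_N(0) = 3 exactly, so the bound has content precisely for large s. [difficulty:
open-problem] (why it might fail: Needs the whole engine: exact lace representation, (C·R(φ))^m
bounds on irreducible ring diagrams despite indirect collision chains (Cohen1967 §4c-d: complete
resummation unproved), and a bootstrap norm tolerating the z^1/2 branch point behind the t^-3/2 tail
(Hara–Slade never work AT criticality).) [Slade2006LaceExpansion, VanDerHofstad2001Ballistic,
HaraSlade1992, Cohen1967, DorfmanCohen1972, AlderWainwright1970, ErnstHaugeVanleeuwen1970,
Spohn1991, VanLeeuwenWeijland1967, Alexander1975]
#3 EquilibriumLinearResponse (crux) — K2 (card K2; the five-charge sector of the bootstrap,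
hydrodynamic poles projected out): Euler-scale LINEAR RESPONSE of the equilibrium hard-sphere gas at
fixed small σ is linearised hs-Euler — along a smooth homotopy of local-Gibbs profiles starting at a
constant state, with a jointly smooth family of classical hs-Euler solutions matching the LLN data,
the covariance under the homogeneous canonical Gibbs law of the initial score Σ_i ∂_κ
log(profile)(z_i) at κ = 0 with the time-t empirical density / momentum / energy field tested
against χ converges to ∂_κ|₀ of the corresponding Euler field (Landau–Placzek structure, Drude
weights of the fast currents zero; Spohn1991 (7.19) in response form). Same normalised signature as
OneParticleInfluence.EquilibriumLinearResponse (stmt-3075, filed there as support): this route wants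
it as a CRUX because it is exactly the output of the small-z bootstrap in the sector orthogonal to
the five charges. [deps: EquilibriumVafEnvelope] [difficulty: open-problem] (why it might fail: The
bootstrap must close in the sector orthogonal to the five charges with the Euler poles projected
out; any O(1) memory surviving ≍N^1/3 collision times (kinetic or ring modes, anomalous sound
damping at fixed σ) adds a non-Euler term — open even at global equilibrium (Spohn1991 (7.19)).)
[Spohn1991, BGSSCPAM2023, ErnstHaugeVanleeuwen1970, Resibois1978, EvansMorriss2008]
#4 LocalEquilibriumMarginals (crux) — K3 (card K3/L4, typed s ≤ 2 shadow): for all continuous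
local-Gibbs profiles there is σ₀ such that for σ < σ₀, every classical hs-Euler solution on [0,T)
matching the data, every family of flows and every t < T, the 1-particle marginal of the transported
local Gibbs density converges to ρ_t M_(u_t,θ_t) in (1+|v|²)²-weighted L¹ and the 2-particle
marginal minus the product of 1-marginals tends to 0 in (1+|v|²)(1+|v′|²)-weighted L¹. Identical
(normalised) signature to DenseKineticExpansion.FixedFractionCumulantExpansion (stmt-0804): the two
routes share the item and differ in the ENGINE — here the self-energy/lace series around the local
Enskog process driven by the Euler solution, uniform on [0, T·N^1/3] kinetic times, with small
parameter R(φ) and time-uniformity from ballistic transience + bootstrap. [deps: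
EquilibriumVafEnvelope, EquilibriumLinearResponse] [difficulty: open-problem] (why it might fail:
Out of equilibrium the reference (local Enskog along hs-Euler) is time-inhomogeneous and one-time
contact statistics are no longer exactly product, so the bubble must be bounded along f_t, not G —
an a-priori ring-density input nobody has; and α = σ²N^1/3 defeats DHM-type counting.)
[DengHaniMa2024, Cohen1967, PulvirentiSimonella2016, BGSSCPAM2023, VanbeijerenErnst1973, Spohn1991]
#9 MarginalsToL2 (support) — marginals ⇒ mean square at time t (folklore variance computation,
Sznitman1991 Prop. 2.2 with unbounded tests): given a.e. permutation symmetry of the transported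
density, weighted-L¹ convergence of the 1-marginal to the local Maxwellian of (ρ_t,u_t,θ_t) and of
the 2-marginal to the product imply the three mean-square field convergences at t. Identical
signature to DenseKineticExpansion.MarginalsToL2 (stmt-0806, checked). [difficulty: M]
[Sznitman1991, GST2013]
#9 FlowMarginalSymmetry (support) — for every σ > 0, profiles, N, every hard-sphere flow Φ of N+1
spheres of diameter σ(N+1)^(-1/3) on 𝕋³, every t and every permutation π of the labels, the
transported local Gibbs density W = 1_D · (canonicalDensity ∘ Φ_(−t)) is volume-a.e. invariant under
relabelling, W(z∘π) = W(z) a.e. — the symmetry hypothesis of MarginalsToL2, discharged for ARBITRARY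
flows: relabelling a HardSphereFlow gives a HardSphereFlow (all fields of IsHardSphereTrajectory /
hardSphereDomain / liouville are label-covariant), any two flows agree Liouville-a.e. at every time
(HardSphereFlow.flow_eq_ae, proved: flow_eq_ae_holds), the canonical density of a one-particle
profile is symmetric, and off the domain both sides vanish. Rests on PROVED cone facts only
(flow_eq_ae_holds, unique_holds). [difficulty: provable-now] [GST2013, Alexander1975, CIP1994]

TWO-LAYER PLAN. Foreseen glued splits once a crux moves (nothing filed now; k ≤ 3, depth 1):
EquilibriumVafEnvelope ⇐ DressedBubbleBound → LaceSelfEnergyBounds → EquilibriumVafEnvelope (L1: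
dressed re-encounter bubble ≤ C φ² log(1/φ) per collision uniformly in the number of collisions,
Palm/GNZ calculus for the low-activity hard-core field + free-flight geometry; L2+L3: lace
representation, (CR)^m diagrammatic bounds, small-z bootstrap — both filed informally at open, to be
typed once the infinite-volume equilibrium dynamics and the ring-closure count exist as Lean
objects); EquilibriumLinearResponse ⇐ StaticScoreResponse-type statics → FiveChargeBootstrap →
EquilibriumLinearResponse; LocalEquilibriumMarginals ⇐ NonEquilibriumBubble (ring density along f_t
on kinetic windows, an LD-transfer input of ring-sparse-collision-forest type) → LaceTransfer (the
expansion around the time-inhomogeneous local Enskog reference given that input) →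
LocalEquilibriumMarginals.

KILL CRITERIA. (i) Factorial growth of the number of irreducible ring topologies at order m NOT
compensated by R(φ)^m (a counting theorem on collision histories of the equilibrium gas), or a proof
that matching the known t^-3/2 amplitude (DorfmanCohen1972; AlderWainwright1970) already requires
infinitely many laces with no small parameter — closes LaceSelfEnergyBounds and the route (close
--reason refuted:LaceSelfEnergyBounds once typed; until then exhausted with census). (ii)
¬EquilibriumVafEnvelope (e.g. a slower-than-t^-3/2 or non-decaying component of the equilibrium VAF
at arbitrarily small fixed σ) refutes the rank-2 crux and closes the route outright:
refuted:EquilibriumVafEnvelope. (iii) ¬EquilibriumLinearResponse closes this route AND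
OneParticleInfluence's κ = 0 foothold without touching the conjunct — pivot impossible (the
five-charge sector is the whole point of X_neq). (iv) ¬LocalEquilibriumMarginals kills this route
and DenseKineticExpansion together (shared item) but not the conjunct (marginal convergence in these
weighted norms is stronger than convergence in probability). (v) LocalEquilibriumMarginals proved
elsewhere (any engine) moots the distinctive content of this route down to the rungs K1–K2, which
stay wanted as theorems in their own right.

NOT DECOMPOSED YET. The engine's own objects — infinite-volume equilibrium hard-sphere dynamics
under the low-density Gibbs field and its tagged-velocity correlation operators, the dressed linear
Enskog reference (χ(φ)·linearBoltzmannOp is available; the spatially shifted Enskog operator is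
DenseKineticExpansion's pending definition request), the ring-closure count on collision histories
and the bubble R(φ), the lace/self-energy kernels Π^(m) and the bootstrap function — are definition
requests, not items; LaceSelfEnergyBounds (crux, rank 5) and DressedBubbleBound (support) are filed
INFORMALLY right after open and typed when those land. Also deliberately not decomposed: the d = 2
litmus (hard disks = critical dimension: logarithmically divergent dressed bubble, no time-uniform
bootstrap — a sanity check of the dictionary, not a route item), the identification D = D_E(1+O(φ²
log φ)) and the exact tail amplitude (refinements of K1), the cubic-velocity uniform-integrability
module shared by every flux route (K3 inherits it), constants σ₀, c, A, K.

CHEAPEST FALSIFIER. Compute, at small φ, the dressed bubble R(φ) and the FIRST irreducible ring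
kernel Π^(1) for the equilibrium VAF explicitly (a finite-dimensional kinetic-theory calculation on
damped Enskog propagators, doable by hand + kit numerics) and compare (a) its long-time coefficient
with the ring-kinetic-theory / mode-coupling tail amplitude α_D (t₀/t)^3/2 of DorfmanCohen1972 and
ErnstHaugeVanleeuwen1970 and with Alder–Wainwright-type MD (AlderWainwright1970), (b) its short-time
size with Sengers' three-body O(φ) correction: if reproducing the KNOWN t^-3/2 amplitude already
needs the infinite resummation of repeated rings with no small parameter (i.e. Π^(1) alone is off by
O(1) at small φ), the (C·R)^m structure of LaceSelfEnergyBounds is dead and K1's envelope loses its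
engine. Second cheapest: read VanDerHofstad2001Ballistic's induction and check whether it tolerates
a branch point of the two-point function at the base point (z = 0 here) — if not, K1 must be
weakened to Cesàro form. Not run here (planner seat, no kit in plancard mode).

NUMBERS. Ballistic critical dimension: ring-closure kernel ∫^∞ dτ τ^-(d−1) converges iff d ≥ 3
(Cohen1967 (13)–(14); NoDensityExpansion kernel (2): ∫_τ₀^T dτ/τ² ≤ τ₀⁻¹ in d = 3, ∫ dτ/τ = log T in
d = 2). Dressed re-encounter bubble: R(φ) = O(φ² log(1/φ)) for excursions longer than a mean free
time (3-body re-aiming ≍ (ε/ℓ)² ≍ φ² per collision; the 4-body ring gives the logarithm, Cohen1967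
§4b (18), VanLeeuwenWeijland1967 (16): D⁻¹ = … + (π³/4)ρ³ ln ρ), while sub-mean-free-time
recollisions are an O(φ) quasi-local three-body vertex (Choh–Uhlenbeck; Sengers). VAF long-time tail
in d = 3: C(t)/C(0) ≃ [12 n (π(D+ν)t)^3/2]⁻¹·(2/3)-type law, i.e. relative amplitude ≍ φ² s^-3/2 in
kinetic units (DorfmanCohen1972; ErnstHaugeVanleeuwen1970; AlderWainwright1970 MD), inside K1's
envelope K σ³ (1+s)^-3/2 with room. Kinetic clock of K1: t = s/((N+1)ε_N²), Boltzmann collision rate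
4√π ≈ 7.09 per unit s at θ = 1. Lace side: SAW bubble condition B(z_c) − 1 ≤ cβ
(Slade2006LaceExpansion Thm 5.8, p. 65 of the held copy), bootstrap Lemma 5.9 (p. 66) with b = 4, a
= 1 + const·β; d_c = 4 diffusive ↦ d_c = 2 ballistic. Items at open: 6 typed (3 cruxes, 2 supports,
1 assembly) + 2 informal filed after open.

DEFINITION REQUESTS. (D1) InfiniteVolumeEquilibriumHardSphereDynamics — the a.s.-defined dynamics of
the infinite hard-sphere gas in ℝ³×ℝ³ under the low-activity hard-core Gibbs field with Maxwellian
velocities (Alexander1975), with its tagged-velocity time-correlation operators; topic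
Literature/MathematicalPhysics/KineticTheory; needed to type LaceSelfEnergyBounds and to upgrade K1
from limsup-in-N to a statement about the limit. (D2) RingClosureCount / dressedRingBubble φ — on a
hard-sphere trajectory, the number of collisions of a tagged particle within its next k collisions
whose partner is causally upstream of it (re-encounter), and R(φ) = sup_k of its expectation per
collision computed with collision-damped flights; topic
Summits/AtomisticToContinuum/HydrodynamicLimit/Theorems (new object posited by this route); needed
for DressedBubbleBound and LaceSelfEnergyBounds. (D3) the linear Enskog collision operator on 𝕋³
with spatial shifts ±εω and contact factor χ(ρσ³) — already wanted by DenseKineticExpansion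
(grounder notes on stmt-0805: enskogCollisionOperator); this route re-uses it, no new request. Cite
facts wanted: none new (Cohen1967, VanLeeuwenWeijland1967, KawasakiOppenheim1967 are transcribed in
the NoDensityExpansion barrier file).

Novelty: Searches (2026-08-15, this seat): `lit search --hybrid "lace expansion self-energy kinetic theory
hard spheres ring collisions resummation"` (12 held docs: CIP1994, Soto2016, Dorfman1999, Slade2006,
MadrasSlade1993 — no junction); `lit search --source zbmath "lace expansion kinetic"` (3:
doi:10.1007/bf01334760, doi:10.4007/annals.2013.178.2.5, doi:10.1007/s11040-022-09441-6 — lattice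
trees / percolation only); zbmath "lace expansion Lorentz gas" (0), "self-interacting random walk
expansion ballistic lace" (0), "long time tail velocity autocorrelation" (14, none rigorous for hard
spheres), "tagged particle hard spheres diffusion deterministic" (0), "Lorentz gas beyond
Boltzmann-Grad limit" (4: LutskoToth2020, arXiv:2501.00519, doi:10.1090/memo/1464), "fluctuation
theory hard sphere gas Boltzmann-Grad" (1: doi:10.1007/s10955-020-02549-5); crossref lookups for
DorfmanCohen1972 / ErnstHaugeVanleeuwen1970 / VanderhofstadHolmes2012; `lit frontier
AtomisticToContinuum --since 2021` (30 rows; kinetic descendants all dilute: arXiv:2602.04407,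
doi:10.1007/s10955-026-03570-w, arXiv:2605.19696); `lit bridges AtomisticToContinuum --cross any`
and `--cross CriticalPhenomena` (no paper joins the HaraSlade/Slade roots to the kinetic roots
except unresolved survey nodes; doi:10.1063/5.0091199 dilute cluster expansion is the closest
kinetic-side descendant); `lit galaxy search "lace expansion" --star pdf` (15 rows, noise), `--star
all "repeated ring kinetic theory"` (panama/crabby queue timeou  [refs: 10.1007/bf01334760, 10.4007/annals.2013.178.2.5, 10.1007/s11040-022-09441-6, 10.1090/memo/1464, 10.1007/s10955-020-02549-5, 10.1007/s10955-026-03570-w, 10.1063/5.0091199, 2501.00519, 2602.04407, 2605.19696, doi:10.1007/bf01334760, doi:10.4007/annals.2013.178.2.5, doi:10.1007/s11040-022-09441-6, doi:10.1090/memo/1464, doi:10.1007/s10955-020-02549-5, doi:10.1007/s10955-026-03570-w, doi:10.1063/5.009]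

Barriers (technique_class: lace-expansion ring-self-energy dressed-propagator-bootstrap): - technique_class: lace-expansion ring-self-energy dressed-propagator-bootstrap
- Literature.Barriers.AtomisticToContinuum.NoDensityExpansionBarrier: applies to the letter of
"expansion of the dynamics" and is evaded by construction — no power series in the density is formed
and no term takes t → ∞ inside a density order: propagators are dressed (collision-damped) BEFORE
any ring is integrated, so every term is finite at fixed φ and the ρ^k log ρ non-analyticities
appear where they should (its narrowed audit, NoDensityExpansionBarrierNarrow scope (g), states that
uniform-in-time bounds at fixed density on resummed objects are constrained by nothing printed); the
barrier's own kernel (2) (∫dτ/τ² < ∞ in d = 3) is this route's super-criticality input; the honest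
residual "complete resummation has not been proved" (Cohen1967 §4c–d) is exactly the informal crux
LaceSelfEnergyBounds.
- Literature.Barriers.AtomisticToContinuum.DiluteRegimeBarrier: evaded in letter and substance — no
Boltzmann–Grad limit anywhere; σ is fixed, the Enskog contact value χ(φ) and the full equation of
state ride in the reference semigroup; K1–K3 are all stated at fixed σ with N → ∞ (the barrier's DHM
cap α ≲ (log|log ε|)^1/2 is not used).
- Literature.Barriers.AtomisticToContinuum.BoltzmannHypothesisBarrier: not in its technique class
(no ergodic/entropy hypothesis); K2 attacks the linear floor of that barrier (Euler-scale response
of the Gibbs state) rather than assuming it; consistent degenerate case: f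

History (route lifecycle, newest last):
- 2026-08-15T13:43:42Z · CLOSED retired — not-a-thesis: assembly does not conclude the sub-problem Statement (operator:999:1257524)

sub-problem: HydrodynamicLimit · status: closed(retired) · opened planner-plancard-AtomisticToContinuum-Hydrody-fc1c47c6-0 2026-08-15T11:41:22Z · rev 0 · ledger route-AtomisticToContinuum-LaceRingBootstrap
GENERATED by the gate from the ledger (D-0016/17). Provers cite these decls: `theorem foo : Summit.AtomisticToContinuum.HydrodynamicLimit.Theses.LaceRingBootstrap.<Decl> := …` in Summits/AtomisticToContinuum/HydrodynamicLimit/Theorems/<Name>.lean.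
-/

namespace Summit.AtomisticToContinuum.HydrodynamicLimit.Theses.LaceRingBootstrap

open scoped BigOperators Topology Manifold Classical MeasureTheory ProbabilityTheory Matrix InnerProductSpace ComplexConjugate ContinuousMap
open Filter Set Function TopologicalSpace MeasureTheory

attribute [summit_statement] _root_.HydrodynamicLimit

/-- item stmt-AtomisticToContinuum-5511 · crux · rank 2 · closed · moot by None · by planner
why it might fail: Needs the whole engine: exact lace representation, (C·R(φ))^m bounds on irreducible ring diagrams despite indirect collision chains (Cohen1967 §4c-d: complete resummation unproved), and a bootstrap norm tolerating the z^1/2 branch point behind the t^-3/2 tail (Hara–Slade never work AT criticality).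
sources: Slade2006LaceExpansion, VanDerHofstad2001Ballistic, HaraSlade1992, Cohen1967, DorfmanCohen1972, AlderWainwright1970
[crux] K1 (card K1/L1–L3 exercised in their home setting): there are σ₀, c > 0 and constants A, K
such that for every reduced density 0 < σ < σ₀, every family of hard-sphere flows of N+1 spheres of
diameter σ(N+1)^(-1/3) on 𝕋³ and every kinetic time s ≥ 0, the equilibrium velocity autocorrelation
C_N(s) = E_G[(N+1)⁻¹ Σ_i v_i(0)·v_i(t)] under the canonical hard-sphere Gibbs law with
unit-temperature Maxwellian velocities (localGibbsLaw σ 1 0 1), read at macroscopic time t =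
s/((N+1)ε_N²) = s/(σ²(N+1)^(1/3)) (s counts mean free times up to the factor 4√π·χ(φ)), satisfies
for every δ > 0 and all large N: |C_N(s)| ≤ 3(A e^(−cs) + K σ³ (1+s)^(−3/2)) + δ. Content: the
tagged velocity decorrelates at fixed positive density for ALL kinetic times with an integrable
envelope — exponential kinetic (Enskog) part plus a ring correction of relative size O(φ) with the
t^(−3/2) long-time-tail exponent — hence finite self-diffusion (Green–Kubo integrable), zero
self-Drude weight, x(t)/t → 0; the lace engine gives more (C = Enskog VAF + ring term ≤ C
R(φ)(1+s)^(−3/2), D = D_E(1+O(φ² log φ))) but the envelope is the typed, falsifiable core. C_N(0) =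
3 exactly, so the bound has content precisely for l -/
@[route_item "route-AtomisticToContinuum-LaceRingBootstrap"]
def EquilibriumVafEnvelope : Prop :=
  ∃ σ₀ : ℝ, 0 < σ₀ ∧ ∃ c : ℝ, 0 < c ∧ ∃ A K : ℝ, ∀ σ : ℝ, 0 < σ → σ < σ₀ → ∀ Φ : (N : ℕ) → Literature.Analysis.FluidPDE.HardSphereFlow (Literature.Analysis.FluidPDE.Torus.geometry (Fin 3)) (Literature.MathematicalPhysics.KineticTheory.hsDiameter σ N) (N + 1), ∀ s : ℝ, 0 ≤ s → ∀ δ : ℝ, 0 < δ → ∀ᶠ N : ℕ in Filter.atTop, |∫ z, ((N + 1 : ℕ) : ℝ)⁻¹ * ∑ i, inner ℝ (z i).2 (((Φ N).flow (s / (((N + 1 : ℕ) : ℝ) * Literature.MathematicalPhysics.KineticTheory.hsDiameter σ N ^ 2)) z) i).2 ∂(Literature.MathematicalPhysics.KineticTheory.localGibbsLaw σ (fun _ => 1) (fun _ => 0) (fun _ => 1) N (Φ N))| ≤ 3 * (A * Real.exp (-(c * s)) + K * σ ^ 3 * (1 + s) ^ (-(3 / 2 : ℝ))) + δ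

/-- item stmt-AtomisticToContinuum-3075 · crux · rank 3 · closed · moot by None · by planner
why it might fail: The bootstrap must close in the sector orthogonal to the five charges with the Euler poles projected out; any O(1) memory surviving ≍N^1/3 collision times (kinetic or ring modes, anomalous sound damping at fixed σ) adds a non-Euler term — open even at global equilibrium (Spohn1991 (7.19)).
sources: Spohn1991, BGSSCPAM2023, ErnstHaugeVanleeuwen1970, Resibois1978, EvansMorriss2008
[support] GLOBAL-EQUILIBRIUM special case (κ = 0) of ScoreLinearResponse: same hypotheses,
conclusion only at κ = 0 where p_0 is the homogeneous canonical Gibbs law: Cov_eq(Σ_i s_0(z_i),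
⟨U_N(t),χ⟩) → ∂_κ|_0 ⟨U_κ(t),χ⟩ = linearised hs-Euler about the constant state applied to the
initial perturbation. This is the LINEAR-RESPONSE form of Spohn1991 Part II §7.1 (7.19) /
Landau–Placzek: Euler-scale equilibrium time correlations of the conserved fields of hard spheres
are transported by linearised Euler (sound modes, entropy/shear modes) — open for every
deterministic model except hard rods; first foothold for provers, MD check for refuters.
[difficulty: open-problem] -/
@[route_item "route-AtomisticToContinuum-LaceRingBootstrap"]
def EquilibriumLinearResponse : Prop :=
  ∀ (a₁ θ₁ : Literature.MathematicalPhysics.KineticTheory.T3 → ℝ) (u₁ : Literature.MathematicalPhysics.KineticTheory.T3 → Literature.MathematicalPhysics.KineticTheory.V3), Continuous a₁ → Continuous θ₁ → Continuous u₁ → (∀ x, 0 < a₁ x) → (∀ x, 0 < θ₁ x) → ∀ Λ : ℝ, 1 ≤ Λ → ∃ σ₀ : ℝ, 0 < σ₀ ∧ ∀ σ : ℝ, 0 < σ → σ < σ₀ → ∀ (a θ₀ : ℝ → Literature.MathematicalPhysics.KineticTheory.T3 → ℝ) (u₀ : ℝ → Literature.MathematicalPhysics.KineticTheory.T3 → Literature.MathematicalPhysics.KineticTheory.V3),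 Literature.Analysis.FunctionSpaces.Torus.IsSmoothSpaceTimeOn (Set.Icc 0 1) a → Literature.Analysis.FunctionSpaces.Torus.IsSmoothSpaceTimeOn (Set.Icc 0 1) θ₀ → Literature.Analysis.FunctionSpaces.Torus.IsSmoothSpaceTimeOn (Set.Icc 0 1) u₀ → (∀ κ ∈ Set.Icc (0 : ℝ) 1, ∀ x, Λ⁻¹ * (⨅ y, a₁ y) ≤ a κ x ∧ a κ x ≤ Λ * (⨆ y, a₁ y) ∧ 0 < θ₀ κ x) → (∀ x, a 0 x = a 0 0 ∧ θ₀ 0 x = θ₀ 0 0 ∧ u₀ 0 x = u₀ 0 0) → a 1 = a₁ → θ₀ 1 = θ₁ → u₀ 1 = u₁ → ∀ (T : ℝ) (ρ θ : ℝ → ℝ → Literature.MathematicalPhysics.KineticTheory.T3 → ℝ) (u : ℝ → ℝ → Literature.MathematicalPhysics.KineticTheory.T3 → Literature.MathematicalPhysics.KineticTheory.V3), (∀ κ ∈ Set.Icc (0 : ℝ) 1, Literature.MathematicalPhysics.KineticTheory.IsHardSphereEulerSolution σ T (ρ κ) (u κ) (θ κ)) → ContDiffOn ℝ ((⊤ :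 ℕ∞) : WithTop ℕ∞) (fun q : ℝ × ℝ × EuclideanSpace ℝ (Fin 3) => ρ q.1 q.2.1 (Literature.Analysis.FunctionSpaces.Torus.proj q.2.2)) (Set.Icc 0 1 ×ˢ (Set.Ico 0 T ×ˢ Set.univ)) → ContDiffOn ℝ ((⊤ : ℕ∞) : WithTop ℕ∞) (fun q : ℝ × ℝ × EuclideanSpace ℝ (Fin 3) => u q.1 q.2.1 (Literature.Analysis.FunctionSpaces.Torus.proj q.2.2)) (Set.Icc 0 1 ×ˢ (Set.Ico 0 T ×ˢ Set.univ)) → ContDiffOn ℝ ((⊤ : ℕ∞) : WithTop ℕ∞) (fun q : ℝ × ℝ × EuclideanSpace ℝ (Fin 3) => θ q.1 q.2.1 (Literature.Analysis.FunctionSpaces.Torus.proj q.2.2)) (Set.Icc 0 1 ×ˢ (Set.Ico 0 T ×ˢ Set.univ)) → ∀ Φ : (N : ℕ) → Literature.Analysis.FluidPDE.HardSphereFlow (Literature.Analysis.FluidPDE.Torus.geometry (Fin 3)) (Literature.MathematicalPhysics.KineticTheory.hsDiameter σ N) (N + 1), (∀ κ ∈ Set.Icc (0 : ℝ) 1, Literature.MathematicalPhysics.KineticTheory.TendstoHydroFieldsAt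 (fun N => Literature.MathematicalPhysics.KineticTheory.localGibbsLaw σ (a κ) (u₀ κ) (θ₀ κ) N (Φ N)) Φ (ρ κ) (u κ) (θ κ) 0) → ∀ t ∈ Set.Ico 0 T, ∀ χ : Literature.MathematicalPhysics.KineticTheory.T3 → ℝ, Continuous χ → let p : ℝ → (N : ℕ) → MeasureTheory.Measure (Literature.Analysis.FluidPDE.Config (N + 1) (Fin 3) Literature.MathematicalPhysics.KineticTheory.T3) := fun κ N => Literature.MathematicalPhysics.KineticTheory.localGibbsLaw σ (a κ) (u₀ κ) (θ₀ κ) N (Φ N); let S : ℝ → (N : ℕ) → Literature.Analysis.FluidPDE.Config (N + 1) (Fin 3) Literature.MathematicalPhysics.KineticTheory.T3 → ℝ := fun κ N z => ∑ i, derivWithin (fun κ' => Real.log (Literature.MathematicalPhysics.KineticTheory.localGibbsProfile (a κ') (u₀ κ') (θ₀ κ') (z i))) (Set.Icc 0 1) κ; Filter.Tendsto (fun N : ℕ => ProbabilityTheory.covariance (S 0 N) (fun z => Literature.MathematicalPhysics.KineticTheory.empiricalDensityField ((Φ N).flow t z) χ) (p 0 N)) Filter.atTop (nhds (derivWithin (fun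 κ' => ∫ x, χ x * ρ κ' t x) (Set.Icc 0 1) 0)) ∧ (∀ j : Fin 3, Filter.Tendsto (fun N : ℕ => ProbabilityTheory.covariance (S 0 N) (fun z => Literature.MathematicalPhysics.KineticTheory.empiricalMomentumField ((Φ N).flow t z) χ j) (p 0 N)) Filter.atTop (nhds (derivWithin (fun κ' => ∫ x, χ x * ρ κ' t x * u κ' t x j) (Set.Icc 0 1) 0))) ∧ Filter.Tendsto (fun N : ℕ => ProbabilityTheory.covariance (S 0 N) (fun z => Literature.MathematicalPhysics.KineticTheory.empiricalEnergyField ((Φ N).flow t z) χ) (p 0 N)) Filter.atTop (nhds (derivWithin (fun κ' => ∫ x, χ x * Literature.MathematicalPhysics.KineticTheory.totalEnergyDensity (ρ κ' t x) (u κ' t x) (θ κ' t x)) (Set.Icc 0 1) 0))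

/-- item stmt-AtomisticToContinuum-0804 · crux · rank 4 · closed · moot by None · by planner
why it might fail: Out of equilibrium the reference (local Enskog along hs-Euler) is time-inhomogeneous and one-time contact statistics are no longer exactly product, so the bubble must be bounded along f_t, not G — an a-priori ring-density input nobody has; and α = σ²N^1/3 defeats DHM-type counting.
sources: DengHaniMa2024, Cohen1967, PulvirentiSimonella2016, BGSSCPAM2023, VanbeijerenErnst1973, Spohn1991
[crux] CUMULANT EXPANSION AT FIXED VOLUME FRACTION: there is σ₀ > 0 such that for σ < σ₀, local
Gibbs data (a₀,u₀,θ₀), a classical hs-Euler solution on [0,T) and t < T, the s-point cumulants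
E_s(τ), τ ∈ [0,t], of the law of N+1 hard spheres of diameter σ(N+1)^{-1/3} on 𝕋³, taken RELATIVE TO
THE LOCAL HARD-SPHERE GIBBS STATE with the block-averaged conserved fields (not relative to a
product state), obey |E_s(τ)| ≤ (Cσ³)^{s−1} uniformly in N in DHM-type weighted L¹ norms
(DengHaniMa2024 arXiv:2408.07818 §1.3; layered cluster-forest / molecule expansion and cutting
algorithm), although α = Nε² = σ²N^{1/3} is a power of N and Nε³ = σ³ does not vanish. Content:
recollision/long-bond combinatorics must be resummed against local equilibrium (Enskog contact
correlation), cf. PulvirentiSimonella2016 (correlation error at Boltzmann–Grad), BGSS2023 (dynamical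
cluster expansion near equilibrium). Refutation (non-summable cumulants relative to local
equilibrium at every fixed σ > 0 on the Euler time scale) closes this route. -/
@[route_item "route-AtomisticToContinuum-LaceRingBootstrap"]
def LocalEquilibriumMarginals : Prop :=
  ∀ (a₀ θ₀ : Literature.MathematicalPhysics.KineticTheory.T3 → ℝ) (u₀ : Literature.MathematicalPhysics.KineticTheory.T3 → Literature.MathematicalPhysics.KineticTheory.V3), Continuous a₀ → Continuous θ₀ → Continuous u₀ → (∀ x, 0 < a₀ x) → (∀ x, 0 < θ₀ x) → ∃ σ₀ : ℝ, 0 < σ₀ ∧ ∀ σ : ℝ, 0 < σ → σ < σ₀ → ∀ (T : ℝ) (ρ θ : ℝ → Literature.MathematicalPhysics.KineticTheory.T3 → ℝ) (u : ℝ → Literature.MathematicalPhysics.KineticTheory.T3 → Literature.MathematicalPhysics.KineticTheory.V3), Literature.MathematicalPhysics.KineticTheory.IsHardSphereEulerSolution σ T ρ u θ → ∀ Φ : (N : ℕ) → Literature.Analysis.FluidPDE.HardSphereFlow (Literature.Analysis.FluidPDE.Torus.geometry (Fin 3)) (Literature.MathematicalPhysics.KineticTheory.hsDiameter σ N) (N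 + 1), Literature.MathematicalPhysics.KineticTheory.TendstoHydroFieldsAt (fun N => Literature.MathematicalPhysics.KineticTheory.localGibbsLaw σ a₀ u₀ θ₀ N (Φ N)) Φ ρ u θ 0 → ∀ t ∈ Set.Ico 0 T, let W : (N : ℕ) → Literature.Analysis.FluidPDE.Config (N + 1) (Fin 3) Literature.MathematicalPhysics.KineticTheory.T3 → ℝ := fun N => (Literature.Analysis.FluidPDE.hardSphereDomain (Literature.Analysis.FluidPDE.Torus.geometry (Fin 3)) (N + 1) (Literature.MathematicalPhysics.KineticTheory.hsDiameter σ N)).indicator (Literature.Analysis.FluidPDE.hsTransport (Φ N) t (Literature.Analysis.FluidPDE.canonicalDensity (Literature.Analysis.FluidPDE.Torus.geometry (Fin 3)) (Literature.MathematicalPhysics.KineticTheory.hsDiameter σ N) (N + 1) (Literature.MathematicalPhysics.KineticTheory.localGibbsProfile a₀ u₀ θ₀))); let g : Literature.MathematicalPhysics.KineticTheory.T3 × Literature.MathematicalPhysics.KineticTheory.V3 → ℝ := fun y => ρ t y.1 * Literature.Analysis.FluidPDE.localMaxwellian 1 (θ t y.1) (u t y.1) y.2; Filter.Tendsto (fun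 N : ℕ => ∫⁻ y : Literature.MathematicalPhysics.KineticTheory.T3 × Literature.MathematicalPhysics.KineticTheory.V3, ENNReal.ofReal ((1 + ‖y.2‖ ^ 2) ^ 2 * |Literature.Analysis.FluidPDE.nthMarginal (N + 1) 1 (W N) (fun _ => y) - g y|)) Filter.atTop (nhds 0) ∧ Filter.Tendsto (fun N : ℕ => ∫⁻ p : (Literature.MathematicalPhysics.KineticTheory.T3 × Literature.MathematicalPhysics.KineticTheory.V3) × (Literature.MathematicalPhysics.KineticTheory.T3 × Literature.MathematicalPhysics.KineticTheory.V3), ENNReal.ofReal ((1 + ‖p.1.2‖ ^ 2) * (1 + ‖p.2.2‖ ^ 2) * |Literature.Analysis.FluidPDE.nthMarginal (N + 1) 2 (W N) ![p.1, p.2] - Literature.Analysis.FluidPDE.nthMarginal (N + 1) 1 (W N) ![p.1] * Literature.Analysis.FluidPDE.nthMarginal (N + 1) 1 (W N) ![p.2]|)) Filter.atTop (nhds 0)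

-- item stmt-AtomisticToContinuum-6613 · support · rank 5 · closed · moot by None · by planner — informal only, no Lean statement yet:
--   [crux] LACE REPRESENTATION + DIAGRAMMATIC BOUNDS + BOOTSTRAP (card L2+L3; the ENGINE of the route,
--   informal until definitions D1/D2 land): for packing φ < φ₀, the Laplace-transformed tagged-particle
--   (and pair) propagator of the infinite-volume equilibrium hard-sphere gas (Alexander1975 dynamics
--   under the low-activity hard-core Gibbs field with Maxwellian velocities) satisfies P̂(z) = [z − ℒ_E
--   − Σ(z)]⁻¹ on L²(M) ⊖ {conserved}, where ℒ_E = −ν χ(φ) L is the DRESSED linear Enskog–Lorentz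
--   reference (L = Literature.MathematicalPhysics.KineticTheory.linearBoltzmannOp, χ = contact value)
--   and Σ(z) = Σ_

/-- item stmt-AtomisticToContinuum-0806 · support · rank 9 · closed · moot by None · by planner
sources: Sznitman1991, GST2013
[crux→typable] MARGINALS ⇒ MEAN SQUARE: if for t < T the 1-particle marginal f¹_N(t) of the time-t
density (transportFn Φ_N of canonicalDensity … (localGibbsProfile a₀ u₀ θ₀)) converges to g_t(x,v) =
ρ_t(x)·localMaxwellian 1 (θ_t x) (u_t x) v in L¹((1+|v|²)dx dv) and the 2-particle marginal f²_N(t)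
− f¹_N(t)⊗f¹_N(t) → 0 in L¹((1+|v|²)(1+|v′|²)), then L2HydroFields holds at t (E|N⁻¹Σφ(z_i) − ∫φg|²
= N⁻¹∫φ²f¹ + (1−N⁻¹)∫φ⊗φ f² − 2∫φf¹∫φg + (∫φg)², φ ∈ {χ, χv, χ|v|²/2}; Sznitman1991 Prop. 2.2 with
unbounded tests). CAVEAT for the typed version: Literature.Analysis.FluidPDE.HardSphereFlow carries
no permutation-equivariance field, so symmetry of the time-t density must be assumed (symmetrised
marginals) or an equivariant flow chosen (flows agree a.e., HardSphereFlow.flow_eq_ae); grounder to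
set-signature accordingly. -/
@[route_item "route-AtomisticToContinuum-LaceRingBootstrap"]
def MarginalsToL2 : Prop :=
  ∀ (σ : ℝ) (a₀ θ₀ : Literature.MathematicalPhysics.KineticTheory.T3 → ℝ) (u₀ : Literature.MathematicalPhysics.KineticTheory.T3 → Literature.MathematicalPhysics.KineticTheory.V3) (ρ θ : ℝ → Literature.MathematicalPhysics.KineticTheory.T3 → ℝ) (u : ℝ → Literature.MathematicalPhysics.KineticTheory.T3 → Literature.MathematicalPhysics.KineticTheory.V3) (Φ : (N : ℕ) → Literature.Analysis.FluidPDE.HardSphereFlow (Literature.Analysis.FluidPDE.Torus.geometry (Fin 3)) (Literature.MathematicalPhysics.KineticTheory.hsDiameter σ N) (N + 1)) (t : ℝ), 0 < σ → Continuous a₀ → Continuous θ₀ → Continuous u₀ → (∀ x, 0 < a₀ x) → (∀ x, 0 < θ₀ x) → Continuous (ρ t) → Continuous (u t) → Continuous (θ t) → (∀ x, 0 < θ t x) → let W : (N : ℕ) → Literature.Analysis.FluidPDE.Config (N + 1) (Fin 3) Literature.MathematicalPhysics.KineticTheory.T3 → ℝ := fun N => (Literature.Analysis.FluidPDE.hardSphereDomain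 (Literature.Analysis.FluidPDE.Torus.geometry (Fin 3)) (N + 1) (Literature.MathematicalPhysics.KineticTheory.hsDiameter σ N)).indicator (Literature.Analysis.FluidPDE.hsTransport (Φ N) t (Literature.Analysis.FluidPDE.canonicalDensity (Literature.Analysis.FluidPDE.Torus.geometry (Fin 3)) (Literature.MathematicalPhysics.KineticTheory.hsDiameter σ N) (N + 1) (Literature.MathematicalPhysics.KineticTheory.localGibbsProfile a₀ u₀ θ₀))); let g : Literature.MathematicalPhysics.KineticTheory.T3 × Literature.MathematicalPhysics.KineticTheory.V3 → ℝ := fun y => ρ t y.1 * Literature.Analysis.FluidPDE.localMaxwellian 1 (θ t y.1) (u t y.1) y.2; (∀ (N : ℕ) (π : Equiv.Perm (Fin (N + 1))), Filter.EventuallyEq (MeasureTheory.ae MeasureTheory.volume) (fun z => W N (z ∘ π)) (W N)) → Filter.Tendsto (fun N : ℕ => ∫⁻ y : Literature.MathematicalPhysics.KineticTheory.T3 × Literature.MathematicalPhysics.KineticTheory.V3, ENNReal.ofReal ((1 + ‖y.2‖ ^ 2) ^ 2 * |Literature.Analysis.FluidPDE.nthMarginal (N + 1) 1 (W N) (fun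 _ => y) - g y|)) Filter.atTop (nhds 0) → Filter.Tendsto (fun N : ℕ => ∫⁻ p : (Literature.MathematicalPhysics.KineticTheory.T3 × Literature.MathematicalPhysics.KineticTheory.V3) × (Literature.MathematicalPhysics.KineticTheory.T3 × Literature.MathematicalPhysics.KineticTheory.V3), ENNReal.ofReal ((1 + ‖p.1.2‖ ^ 2) * (1 + ‖p.2.2‖ ^ 2) * |Literature.Analysis.FluidPDE.nthMarginal (N + 1) 2 (W N) ![p.1, p.2] - Literature.Analysis.FluidPDE.nthMarginal (N + 1) 1 (W N) ![p.1] * Literature.Analysis.FluidPDE.nthMarginal (N + 1) 1 (W N) ![p.2]|)) Filter.atTop (nhds 0) → ∀ χ : Literature.MathematicalPhysics.KineticTheory.T3 → ℝ, Continuous χ → Filter.Tendsto (fun N : ℕ => ∫⁻ z, ENNReal.ofReal (|Literature.MathematicalPhysics.KineticTheory.empiricalDensityField ((Φ N).flow t z) χ - ∫ x, χ x * ρ t x| ^ 2) ∂(Literature.MathematicalPhysics.KineticTheory.localGibbsLaw σ a₀ u₀ θ₀ N (Φ N))) Filter.atTop (nhds 0) ∧ Filter.Tendsto (fun N : ℕ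 => ∫⁻ z, ENNReal.ofReal (‖Literature.MathematicalPhysics.KineticTheory.empiricalMomentumField ((Φ N).flow t z) χ - ∫ x, (χ x * ρ t x) • u t x‖ ^ 2) ∂(Literature.MathematicalPhysics.KineticTheory.localGibbsLaw σ a₀ u₀ θ₀ N (Φ N))) Filter.atTop (nhds 0) ∧ Filter.Tendsto (fun N : ℕ => ∫⁻ z, ENNReal.ofReal (|Literature.MathematicalPhysics.KineticTheory.empiricalEnergyField ((Φ N).flow t z) χ - ∫ x, χ x * Literature.MathematicalPhysics.KineticTheory.totalEnergyDensity (ρ t x) (u t x) (θ t x)| ^ 2) ∂(Literature.MathematicalPhysics.KineticTheory.localGibbsLaw σ a₀ u₀ θ₀ N (Φ N))) Filter.atTop (nhds 0)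

/-- item stmt-AtomisticToContinuum-5512 · support · rank 9 · closed · moot by None · by planner
sources: GST2013, Alexander1975, CIP1994
[support] for every σ > 0, profiles, N, every hard-sphere flow Φ of N+1 spheres of diameter
σ(N+1)^(-1/3) on 𝕋³, every t and every permutation π of the labels, the transported local Gibbs
density W = 1_D · (canonicalDensity ∘ Φ_(−t)) is volume-a.e. invariant under relabelling, W(z∘π) =
W(z) a.e. — the symmetry hypothesis of MarginalsToL2, discharged for ARBITRARY flows: relabelling a
HardSphereFlow gives a HardSphereFlow (all fields of IsHardSphereTrajectory / hardSphereDomain /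
liouville are label-covariant), any two flows agree Liouville-a.e. at every time
(HardSphereFlow.flow_eq_ae, proved: flow_eq_ae_holds), the canonical density of a one-particle
profile is symmetric, and off the domain both sides vanish. Rests on PROVED cone facts only
(flow_eq_ae_holds, unique_holds). [difficulty: provable-now] -/
@[route_item "route-AtomisticToContinuum-LaceRingBootstrap"]
def FlowMarginalSymmetry : Prop :=
  ∀ (σ : ℝ) (a₀ θ₀ : Literature.MathematicalPhysics.KineticTheory.T3 → ℝ) (u₀ : Literature.MathematicalPhysics.KineticTheory.T3 → Literature.MathematicalPhysics.KineticTheory.V3), 0 < σ → ∀ (N : ℕ) (Φ : Literature.Analysis.FluidPDE.HardSphereFlow (Literature.Analysis.FluidPDE.Torus.geometry (Fin 3)) (Literature.MathematicalPhysics.KineticTheory.hsDiameter σ N) (N + 1)) (t : ℝ) (π : Equiv.Perm (Fin (N + 1))), let W : Literature.Analysis.FluidPDE.Config (N + 1) (Fin 3) Literature.MathematicalPhysics.KineticTheory.T3 → ℝ := (Literature.Analysis.FluidPDE.hardSphereDomain (Literature.Analysis.FluidPDE.Torus.geometry (Fin 3)) (N + 1) (Literature.MathematicalPhysics.KineticTheory.hsDiameter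 σ N)).indicator (Literature.Analysis.FluidPDE.hsTransport Φ t (Literature.Analysis.FluidPDE.canonicalDensity (Literature.Analysis.FluidPDE.Torus.geometry (Fin 3)) (Literature.MathematicalPhysics.KineticTheory.hsDiameter σ N) (N + 1) (Literature.MathematicalPhysics.KineticTheory.localGibbsProfile a₀ u₀ θ₀))); Filter.EventuallyEq (MeasureTheory.ae MeasureTheory.volume) (fun z => W (z ∘ π)) W

-- item stmt-AtomisticToContinuum-6641 · support · rank 9 · closed · moot by None · by planner — informal only, no Lean statement yet:
--   [support] DRESSED BUBBLE BOUND IN EQUILIBRIUM (card L1; provable once definition D2 = ring-closure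
--   count lands): under the low-density hard-sphere Gibbs state at packing φ < φ₀ (infinite volume, or
--   N+1 spheres of diameter σ(N+1)^(−1/3) on 𝕋³ uniformly in N), the expected number of RING CLOSURES —
--   collisions of the tagged particle (or of a particle causally downstream of it) with a particle
--   causally upstream of it, the intervening excursion exceeding one mean free time — among its next k
--   collisions, computed with the collisionally damped free-flight distribution, is ≤ C φ² log(1/φ) · k
--   uniforml

/-- item stmt-AtomisticToContinuum-5513 · assembly · rank 1 · closed · moot by None · by planner
sources: Sznitman1991, Spohn1991, OllaVaradhanYau1993
[assembly] LocalEquilibriumMarginals → MarginalsToL2 → FlowMarginalSymmetry → HydrodynamicLimit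
(Chebyshev + plumbing). -/
@[route_item "route-AtomisticToContinuum-LaceRingBootstrap"]
def Assembly : Prop :=
  LocalEquilibriumMarginals → MarginalsToL2 → FlowMarginalSymmetry → Literature.MathematicalPhysics.KineticTheory.HydrodynamicLimit

end Summit.AtomisticToContinuum.HydrodynamicLimit.Theses.LaceRingBootstrap
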